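import Literature.MathematicalPhysics.QuantumFieldTheory.Balaban1983to89.B6SectCTwoScaleV1Lattice
import Literature.MathematicalPhysics.QuantumFieldTheory.Balaban1983to89.B6Hprime2101TorusAlgebra
import Literature.MathematicalPhysics.QuantumFieldTheory.Balaban1983to89.B5Eq147TorusBridge

/-!
# `Balaban1983to89.B6Hprime2101TwoScaleV1Torus` — T. Bałaban, *Propagators and renormalization transformations for lattice gauge
# theories. II*, Commun. Math. Phys. **96** (1984) 223–250 [Balaban1984PropagatorsII], p. 241 (2.101)–(2.102) and p. 246 (2.132):
# the `H′_j` of the CONCRETE two-scale V1 data `tsV1` (this seat's variational construction `…B6SectCTwoScaleV1Lattice.hP`) IS r03's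
# TYPED TORUS OPERATOR `…B6Hprime2132Torus.HpOp` (the operator with the printed momentum representation (2.132), whose kernel decay
# and Hölder bounds are proved in the tree) — transported along the V1 ↔ tower ↔ one-stroke-torus identifications of p38/p21

statement-level skeleton of published theorems with citation tags; proofs where landed; nothing here is a claim about the Yang–Mills mass gap

PDF held: `paper:balaban1984-cmp96-propagators-rt-ii` (journal page = PDF page + 222; pp. 241, 246 [PDF 19, 24] read from the materialised
text `~/.lit/texts/paper-balaban1984-cmp96-propagators-rt-ii/`, this seat's lineage, 2026-08-21).

PRINT (verbatim, text layer / r03's image reading).  p. 241: *"λ = Δ⁻²Q′_j*(Q′_jΔ⁻²Q′_j*)⁻¹μ, μ = Q′_jλ (2.101) … It gives a solution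
of the variational problem inf_{λ′:Q′_jλ′=μ} ½‖Δλ′‖². Let us denote the operator in (2.101) by H′_j, so λ = H′_jμ. From the momentum
representation of (2.101) we may get easily that H′_j is a bounded operator with an exponential decay, the bound and decay rate
depending on d only"*; p. 246: *"The operator H′_j can be investigated using the momentum representation obtained from (2.101)
[(2.132)]. This representation together with the analyticity method described in [3] imply that derivatives of H′_j up to third order,
and their local Hölder norms as in (2.67), are uniformly bounded and have a uniform exponential decay with a decay rate depending on d
only."*

CITATION HEADER (lean-in-tree rule) — WHAT IS REPRODUCED.  Phase-2 file of the `lit-balaban` typed skeleton (HOME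
`run/shared/lean/pub/lit-balaban/`), seat **p22 gen 9** (B6 fold owner r03, referee ref-4).  KNITTING of SKELETON rows **B6.Eq2.98** /
**B6.Eq2.132** (decls of record: r03's typed torus operator `…B6Hprime2132Torus.HpOp n M` with `QsOp_HpOp_mulVec` (Q′_jH′_j = I),
`dft_HpOp` ((2.132)), `norm_HpOp_le` (kernel decay), `norm_dker_le`/`norm_dker_sub_le` (derivatives, Hölder), and
`…B6Hprime2101TorusAlgebra.variational_2102`/`eq_HpOp_of_minimiser` ((2.102) + uniqueness), p253600/p254233 — untouched) with the
CONCRETE two-scale data of this seat's gen 8 (`…B6SectCTwoScaleV1Lattice.hP hc j` = the field `hP` of `tsV1 hc Λ′ w` (rfl), its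
`Qp_hP` (2.101) and `hP_orth` (2.98), p257090 — untouched), through the carrier identifications of p38/p21 (`…B5Eq117TorusCarriers.tS`/
`tSc`/`eK`/`EK`/`Qsk_tS`, `…B5Eq147TorusBridge.Lap_tS`/`inner_tS`, `…B5TowerOneStroke.towerE`/`trS`/`cplxS_Qsk`/`reC`,
`…B5HkOpLandauMin.LapS_towerE`/`star_trS_dotProduct_trS`/`star_cplxS_dotProduct_cplxS`, `…B5RealFields.isReal_LapS`/`isReal_QsOp`
— untouched), for every fine-lattice factor `c ≠ 0` and every `j ≤ m + K`:
* §1 the transport `λ ↦ λ̃ := trS (towerE) (cplxS (tS λ))` of fine-lattice scalar fields of the V1 calculus to r03's one-stroke fine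
  torus `Tor (fine (L^j) (Mk P j))`, read pointwise (`transport_apply`, `transport_EK`), with **`Q′_j λ̃ = (Q′_jλ)~`** (`QsOp_transport`,
  p21/p38's (1.20) dictionaries), **`Δ λ̃ = (Δλ)~`** for `Δ = LapS … (L^j)` / `laplace (L^j)` (`LapS_transport`) and the pairing
  (`star_transport_dotProduct_transport`);
* §2 the variational characterisation of `hP` on V1 for EVERY Laplacian weight: `⟨Δn, ΔH′_jμ⟩ = 0` for `n ∈ N(Q′_j)` (`lapE_eq_smul`,
  `inner_lapE_hP_orth`) and **`‖ΔH′_jμ‖ ≤ ‖Δλ′‖` whenever `Q′_jλ′ = μ`** (`norm_lapE_hP_le`, Pythagoras) — p. 241 *"It gives a solution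
  of the variational problem"* for the concrete operator;
* §3 (private plumbing) real parts on the one-stroke torus: a matrix with real entries commutes with `Re`, `‖Re v‖² ≤ ‖v‖²`;
* §4 **THE IDENTIFICATION `(H′_jμ)~ = HpOp (L^j) (Mk P j) · μ̃`** (`transport_hP_eq_HpOp`): `Q′_j(H′_jμ)~ = μ̃` by §1 + `Qp_hP`, and `(H′_jμ)~`
  has least `‖Δ·‖²` among all complex `λ′` with `Q′_jλ′ = μ̃` (by §2 it beats the real competitor `Re(HpOp μ̃)`, which by §3 beats
  `HpOp μ̃`), so r03's uniqueness `eq_HpOp_of_minimiser` applies; pointwise **`(H′_jμ)(x) = Σ_y HpOp (EK x) y · μ(y)`** (`hP_apply_eq_sum`)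
  and **the matrix of the concrete `H′_j` in the site bases IS `Re` of r03's kernel** (`hP_single_apply`), whence the p. 241 / p. 246
  bounds for the CONCRETE `H′_j` are r03's `norm_HpOp_le` / `norm_dker_le` / `norm_dker_sub_le` BY NAME (`abs_hP_single_le_norm_HpOp`:
  `|H′_j(x, y)| ≤ ‖HpOp (EK x) y‖`); `hP_indep` (the construction does not depend on the Laplacian weight `c`); `tsV1_hP` records
  that this `H′_j` is the field `hP` of the two-scale data.
THEOREMS ONLY (no definition, no `def … : Prop`, nothing is a named unproved fact; standard axioms).  HONEST SCOPE: finite tori of the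
V1 calculus (`Site P 0 ≃ Tor (fine (L^j) (Mk P j))` by p38's `EK`); the decay constants themselves are r03's (stated there in dimension
`d + 1 ≥ 1`) and are not restated; NOT summit progress.
-/

noncomputable section

open scoped InnerProductSpace Matrix ComplexConjugate

namespace Literature.MathematicalPhysics.QuantumFieldTheory.Balaban1983to89.B6Hprime2101TwoScaleV1Torus

open LatticeFieldCalculus B5SectBStatements B5Eq117TorusCarriers B6SectAOperatorsV1 B6SectCTwoScaleV1 B6SectCTwoScaleV1Lattice
open B5Prop11Plancherel (Tor fine)
open B5Action121 (LapS)
open B5Block118 (QsOp)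
open B5TowerOneStroke (towerE trS trS_apply' cplxS_Qsk reC reC_apply)
open B5HkOpLandauMin (LapS_towerE star_trS_dotProduct_trS star_cplxS_dotProduct_cplxS)
open B5Eq147TorusBridge (Lap_tS inner_tS)
open B5RealFields (IsReal isReal_LapS isReal_QsOp)
open B6Hprime2132Torus (HpOp QsOp_HpOp_mulVec)
open B6Hprime2101TorusAlgebra (eq_HpOp_of_minimiser)

variable {P : Params} {c : ℝ} (hc : c ≠ 0) {j : ℕ} (hj : j ≤ P.m + P.K)

/-! ## §1  The transport `λ ↦ λ̃ = trS (towerE) (cplxS (tS λ))` and its dictionaries for `Q′_j`, `Δ`, `⟨·,·⟩` -/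

/-- `λ̃(z) = λ(EK⁻¹z)`. [cite: Balaban1984PropagatorsI, (1.20) p.20] -/
theorem transport_apply (lam : SiteField P 0 ℝ) (z : Tor (fine (P.L ^ j) (Mk P j))) :
    trS (towerE P.L (Mk P j) j) (cplxS (tS hj lam)) z = ((lam ((EK hj).symm z) : ℝ) : ℂ) := by
  rw [trS_apply']
  rfl

/-- `λ̃(EK x) = λ(x)`. [cite: Balaban1984PropagatorsI, (1.20) p.20] -/
theorem transport_EK (lam : SiteField P 0 ℝ) (x : Site P 0) :
    trS (towerE P.L (Mk P j) j) (cplxS (tS hj lam)) (EK hj x) = ((lam x : ℝ) : ℂ) := by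
  rw [transport_apply, Equiv.symm_apply_apply]

/-- the transport of unit-lattice fields: `μ̃(y) = μ(y)` (`Site P j` is `Tor (Mk P j)`). [cite: Balaban1984PropagatorsI, (1.20) p.20] -/
theorem transportC_apply (mu : SiteField P j ℝ) (y : Tor (Mk P j)) : cplxS (tSc mu) y = ((mu y : ℝ) : ℂ) := rfl

/-- **`Q′_j λ̃ = (Q′_jλ)~`**: r03's block mean `QsOp` of the transported field is the transported V1 `siteAvgIter j` (p21's `cplxS_Qsk` +
p38's `Qsk_tS`). [cite: Balaban1984PropagatorsI, (1.20) p.20] -/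
theorem QsOp_transport (lam : SiteField P 0 ℝ) :
    QsOp (P.L ^ j) (Mk P j) *ᵥ trS (towerE P.L (Mk P j) j) (cplxS (tS hj lam)) = cplxS (tSc (siteAvgIter j lam)) := by
  rw [← cplxS_Qsk, Qsk_tS]

/-- **`Δ λ̃ = (Δλ)~`** for r03's `LapS (fine (L^j) M) (L^j)` and the V1 `laplace (L^j)` (p38's `Lap_tS` + `LapS_towerE`).
[cite: Balaban1984PropagatorsII, (2.99) p.240] -/
theorem LapS_transport (lam : SiteField P 0 ℝ) :
    LapS (fine (P.L ^ j) (Mk P j)) ((P.L ^ j : ℕ) : ℂ) *ᵥ trS (towerE P.L (Mk P j) j) (cplxS (tS hj lam)) =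
      trS (towerE P.L (Mk P j) j) (cplxS (tS hj (laplace ((P.L : ℝ) ^ j) lam))) := by
  rw [LapS_towerE, Lap_tS]

/-- … for `ℓ²` fields: `Δ(λ̃) = (lapE (L^j) λ)~`. [cite: Balaban1984PropagatorsII, (2.99) p.240] -/
theorem LapS_transport_ofLp (f : ScalarSpace P) :
    LapS (fine (P.L ^ j) (Mk P j)) ((P.L ^ j : ℕ) : ℂ) *ᵥ trS (towerE P.L (Mk P j) j) (cplxS (tS hj (WithLp.ofLp f))) =
      trS (towerE P.L (Mk P j) j) (cplxS (tS hj (WithLp.ofLp (lapE ((P.L : ℝ) ^ j) f)))) := by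
  rw [LapS_transport, ofLp_lapE]

/-- the transport is isometric: `⟨λ̃, λ̃′⟩ = Σ_x λ(x)λ′(x)`. [cite: Balaban1984PropagatorsI, (1.21) p.21] -/
theorem star_transport_dotProduct_transport (f g : SiteField P 0 ℝ) :
    star (trS (towerE P.L (Mk P j) j) (cplxS (tS hj f))) ⬝ᵥ trS (towerE P.L (Mk P j) j) (cplxS (tS hj g)) =
      ((∑ x : Site P 0, f x * g x : ℝ) : ℂ) := by
  rw [star_trS_dotProduct_trS, star_cplxS_dotProduct_cplxS, inner_tS]

/-- hence `‖Δ λ̃‖² = ‖lapE (L^j) λ‖²`. [cite: Balaban1984PropagatorsII, (2.102) p.241] -/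
theorem re_star_LapS_transport (f : ScalarSpace P) :
    (star (LapS (fine (P.L ^ j) (Mk P j)) ((P.L ^ j : ℕ) : ℂ) *ᵥ trS (towerE P.L (Mk P j) j) (cplxS (tS hj (WithLp.ofLp f)))) ⬝ᵥ
        (LapS (fine (P.L ^ j) (Mk P j)) ((P.L ^ j : ℕ) : ℂ) *ᵥ trS (towerE P.L (Mk P j) j) (cplxS (tS hj (WithLp.ofLp f))))).re =
      ‖lapE ((P.L : ℝ) ^ j) f‖ ^ 2 := by
  rw [LapS_transport_ofLp, star_transport_dotProduct_transport, Complex.ofReal_re, ← real_inner_self_eq_norm_sq, inner_eq_sum]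

/-! ## §2  (2.101)–(2.102) on V1: `H′_jμ` has least `‖Δλ′‖` among `Q′_jλ′ = μ`, for every Laplacian weight -/

/-- `lapE c′ = c′²·lapE 1`. [cite: Balaban1984PropagatorsII, (2.8) p.224] -/
theorem lapE_eq_smul (c' : ℝ) (f : ScalarSpace P) : lapE c' f = c' ^ 2 • lapE (1 : ℝ) f := by
  apply PiLp.ext
  intro x
  rw [PiLp.smul_apply, lapE_apply, lapE_apply, B5Eq147TorusBridge.laplace_eq_smul c', Pi.smul_apply]

/-- **(2.98) for every weight**: `⟨Δn, ΔH′_jμ⟩ = 0` for `n ∈ N(Q′_j)`, `Δ = lapE c′` (gen 8's `hP_orth` is the case `c′ = c`).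
[cite: Balaban1984PropagatorsII, (2.98) p.240] -/
theorem inner_lapE_hP_orth (c' : ℝ) (n : ScalarSpace P) (hn : n ∈ LinearMap.ker (Qp P j)) (μ : USite P j) :
    ⟪lapE c' n, lapE c' (hP hc j μ)⟫_ℝ = 0 := by
  have h := hP_orth hc ⟨n, hn⟩ μ
  rw [Submodule.coe_mk, lapE_eq_smul c n, lapE_eq_smul c (hP hc j μ), inner_smul_left, inner_smul_right] at h
  have hc4 : (c ^ 2 : ℝ) * c ^ 2 ≠ 0 := by positivity
  have h1 : ⟪lapE (1 : ℝ) n, lapE (1 : ℝ) (hP hc j μ)⟫_ℝ = 0 := by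
    rw [← mul_assoc] at h
    simpa [hc4] using h
  rw [lapE_eq_smul c' n, lapE_eq_smul c' (hP hc j μ), inner_smul_left, inner_smul_right, h1, mul_zero, mul_zero]

/-- **(2.102) for the concrete `H′_j`**: `‖ΔH′_jμ‖ ≤ ‖Δλ′‖` for every `λ′` with `Q′_jλ′ = μ` (p. 241 *"It gives a solution of the
variational problem inf_{λ′:Q′_jλ′=μ} ½‖Δλ′‖²"*), every weight `c′`. [cite: Balaban1984PropagatorsII, (2.102) p.241] -/
theorem norm_lapE_hP_le (hj : j ≤ P.m + P.K) (c' : ℝ) (μ : USite P j) (lam' : ScalarSpace P) (hlam' : Qp P j lam' = μ) :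
    ‖lapE c' (hP hc j μ)‖ ≤ ‖lapE c' lam'‖ := by
  have hn : lam' - hP hc j μ ∈ LinearMap.ker (Qp P j) := by
    rw [LinearMap.mem_ker, map_sub, hlam', ← LinearMap.comp_apply, Qp_hP hc hj, LinearMap.id_apply, sub_self]
  have horth : ⟪lapE c' (hP hc j μ), lapE c' (lam' - hP hc j μ)⟫_ℝ = 0 := by
    rw [real_inner_comm]
    exact inner_lapE_hP_orth hc c' _ hn μ
  have hsplit : lapE c' lam' = lapE c' (hP hc j μ) + lapE c' (lam' - hP hc j μ) := by
    rw [map_sub, add_sub_cancel]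
  have hpy := norm_add_sq_eq_norm_sq_add_norm_sq_of_inner_eq_zero _ _ horth
  rw [← hsplit] at hpy
  nlinarith [norm_nonneg (lapE c' (hP hc j μ)), norm_nonneg (lapE c' lam'), norm_nonneg (lapE c' (lam' - hP hc j μ))]

/-! ## §3  Real parts on the one-stroke torus -/

/-- a matrix with real entries commutes with taking real parts. [folklore] -/
private theorem mulVec_reC {m k : Type*} [Fintype k] {A : Matrix m k ℂ} (hA : IsReal A) (f : k → ℂ) :
    A *ᵥ reC f = reC (A *ᵥ f) := by
  funext i
  simp only [Matrix.mulVec, dotProduct, reC_apply]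
  apply Complex.ext
  · rw [Complex.re_sum, Complex.ofReal_re, Complex.re_sum]
    refine Finset.sum_congr rfl fun x _ => ?_
    rw [Complex.mul_re, Complex.mul_re, Complex.ofReal_re, Complex.ofReal_im, mul_zero, sub_zero, hA.im_eq_zero, zero_mul,
      sub_zero]
  · rw [Complex.im_sum, Complex.ofReal_im]
    refine Finset.sum_eq_zero fun x _ => ?_
    rw [Complex.mul_im, Complex.ofReal_re, Complex.ofReal_im, mul_zero, zero_add, hA.im_eq_zero, zero_mul]

/-- `Re⟨v, v⟩ = Σ |v_i|²`. [folklore] -/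
private theorem re_star_dotProduct_self {ι : Type*} [Fintype ι] (v : ι → ℂ) :
    (star v ⬝ᵥ v).re = ∑ i, Complex.normSq (v i) := by
  rw [dotProduct, Complex.re_sum]
  refine Finset.sum_congr rfl fun i _ => ?_
  rw [Pi.star_apply, Complex.star_def, Complex.mul_re, Complex.conj_re, Complex.conj_im, Complex.normSq_apply]
  ring

/-- `‖Re v‖² ≤ ‖v‖²`. [folklore] -/
private theorem re_star_dotProduct_reC_le {ι : Type*} [Fintype ι] (v : ι → ℂ) :
    (star (reC v) ⬝ᵥ reC v).re ≤ (star v ⬝ᵥ v).re := by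
  rw [re_star_dotProduct_self, re_star_dotProduct_self]
  refine Finset.sum_le_sum fun i _ => ?_
  rw [reC_apply, Complex.normSq_ofReal, Complex.normSq_apply]
  nlinarith [mul_self_nonneg (v i).im]

/-- a real field is its own real part. [folklore] -/
private theorem reC_transportC (mu : SiteField P j ℝ) : reC (cplxS (tSc mu)) = cplxS (tSc mu) := by
  funext y
  rw [reC_apply, transportC_apply, Complex.ofReal_re]

/-! ## §4  The concrete `H′_j` IS r03's typed torus operator -/

/-- **`(H′_jμ)~ = HpOp (L^j) (Mk P j) · μ̃`** — the variational `H′_j` of the two-scale V1 data, transported to the one-stroke torus, is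
r03's typed operator of (2.101)/(2.132). [cite: Balaban1984PropagatorsII, (2.101)–(2.102) p.241 + (2.132) p.246] -/
theorem transport_hP_eq_HpOp (μ : USite P j) :
    trS (towerE P.L (Mk P j) j) (cplxS (tS hj (WithLp.ofLp (hP hc j μ)))) =
      HpOp (P.L ^ j) (Mk P j) *ᵥ cplxS (tSc (WithLp.ofLp μ)) := by
  set lam' := trS (towerE P.L (Mk P j) j) (cplxS (tS hj (WithLp.ofLp (hP hc j μ)))) with hlam'
  set μf := cplxS (tSc (WithLp.ofLp μ)) with hμf
  set lam0 := HpOp (P.L ^ j) (Mk P j) *ᵥ μf with hlam0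
  have hconj : conj ((P.L ^ j : ℕ) : ℂ) = ((P.L ^ j : ℕ) : ℂ) := Complex.conj_natCast _
  -- `Q′_j(H′_jμ)~ = μ̃`
  have hQμ : siteAvgIter j (WithLp.ofLp (hP hc j μ)) = WithLp.ofLp μ := by
    rw [← ofLp_Qp, ← LinearMap.comp_apply, Qp_hP hc hj, LinearMap.id_apply]
  have hlam : QsOp (P.L ^ j) (Mk P j) *ᵥ lam' = μf := by
    rw [hlam', QsOp_transport hj, hQμ]
  -- the real competitor `Re(HpOp μ̃)` as the transport of a V1 field
  set lamV : SiteField P 0 ℝ := fun x => (lam0 (EK hj x)).re with hlamV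
  have hT : trS (towerE P.L (Mk P j) j) (cplxS (tS hj lamV)) = reC lam0 := by
    funext z
    rw [transport_apply, reC_apply, hlamV]
    simp only [Equiv.apply_symm_apply]
  have hQu : QsOp (P.L ^ j) (Mk P j) *ᵥ reC lam0 = μf := by
    rw [mulVec_reC (isReal_QsOp (P.L ^ j) (Mk P j)), hlam0, QsOp_HpOp_mulVec, hμf, reC_transportC]
  have hQlamV : Qp P j (WithLp.toLp 2 lamV) = μ := by
    have h1 := QsOp_transport hj lamV
    rw [hT, hQu, hμf] at h1
    apply PiLp.ext
    intro y
    have h2 := congr_fun h1 y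
    rw [transportC_apply, transportC_apply, Complex.ofReal_inj] at h2
    show siteAvgIter j (WithLp.ofLp (WithLp.toLp 2 lamV)) y = WithLp.ofLp μ y
    rw [WithLp.ofLp_toLp, ← h2]
  -- minimality: `‖Δ(H′_jμ)~‖² ≤ ‖Δ Re(lam0)‖² ≤ ‖Δ lam0‖²`
  have hmin1 := norm_lapE_hP_le hc hj ((P.L : ℝ) ^ j) μ (WithLp.toLp 2 lamV) hQlamV
  have hmin : (star (LapS (fine (P.L ^ j) (Mk P j)) ((P.L ^ j : ℕ) : ℂ) *ᵥ lam') ⬝ᵥ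
        (LapS (fine (P.L ^ j) (Mk P j)) ((P.L ^ j : ℕ) : ℂ) *ᵥ lam')).re ≤
      (star (LapS (fine (P.L ^ j) (Mk P j)) ((P.L ^ j : ℕ) : ℂ) *ᵥ lam0) ⬝ᵥ
        (LapS (fine (P.L ^ j) (Mk P j)) ((P.L ^ j : ℕ) : ℂ) *ᵥ lam0)).re := by
    calc (star (LapS (fine (P.L ^ j) (Mk P j)) ((P.L ^ j : ℕ) : ℂ) *ᵥ lam') ⬝ᵥ
          (LapS (fine (P.L ^ j) (Mk P j)) ((P.L ^ j : ℕ) : ℂ) *ᵥ lam')).re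
        = ‖lapE ((P.L : ℝ) ^ j) (hP hc j μ)‖ ^ 2 := by rw [hlam', re_star_LapS_transport hj]
      _ ≤ ‖lapE ((P.L : ℝ) ^ j) (WithLp.toLp 2 lamV)‖ ^ 2 := by gcongr
      _ = (star (LapS (fine (P.L ^ j) (Mk P j)) ((P.L ^ j : ℕ) : ℂ) *ᵥ trS (towerE P.L (Mk P j) j) (cplxS (tS hj lamV))) ⬝ᵥ
          (LapS (fine (P.L ^ j) (Mk P j)) ((P.L ^ j : ℕ) : ℂ) *ᵥ trS (towerE P.L (Mk P j) j) (cplxS (tS hj lamV)))).re := by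
          rw [← re_star_LapS_transport hj (WithLp.toLp 2 lamV), WithLp.ofLp_toLp]
      _ = (star (reC (LapS (fine (P.L ^ j) (Mk P j)) ((P.L ^ j : ℕ) : ℂ) *ᵥ lam0)) ⬝ᵥ
          reC (LapS (fine (P.L ^ j) (Mk P j)) ((P.L ^ j : ℕ) : ℂ) *ᵥ lam0)).re := by
          rw [hT, mulVec_reC (isReal_LapS (fine (P.L ^ j) (Mk P j)) hconj)]
      _ ≤ _ := re_star_dotProduct_reC_le _
  exact eq_HpOp_of_minimiser (P.L ^ j) (Mk P j) μf lam' hlam hmin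

/-- **pointwise: `(H′_jμ)(x) = (HpOp μ̃)(EK x)`.** [cite: Balaban1984PropagatorsII, (2.101) p.241 + (2.132) p.246] -/
theorem hP_apply_eq (μ : USite P j) (x : Site P 0) :
    ((hP hc j μ x : ℝ) : ℂ) = (HpOp (P.L ^ j) (Mk P j) *ᵥ cplxS (tSc (WithLp.ofLp μ))) (EK hj x) := by
  rw [← transport_hP_eq_HpOp hc hj μ, transport_EK]

/-- **… = `Σ_y HpOp (EK x) y · μ(y)`** (r03's kernel `hker`; the sum is real). [cite: Balaban1984PropagatorsII, (2.132) p.246] -/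
theorem hP_apply_eq_sum (μ : USite P j) (x : Site P 0) :
    ((hP hc j μ x : ℝ) : ℂ) = ∑ y : Site P j, HpOp (P.L ^ j) (Mk P j) (EK hj x) y * ((μ y : ℝ) : ℂ) := by
  rw [hP_apply_eq hc hj μ x]
  simp only [Matrix.mulVec, dotProduct]
  rfl

/-- **the matrix of the concrete `H′_j` in the site bases IS the real part of r03's kernel**: `H′_j(x, y) = Re (HpOp (EK x) y)`.
[cite: Balaban1984PropagatorsII, (2.132) p.246] -/
theorem hP_single_apply (y : Site P j) (x : Site P 0) :
    hP hc j (PiLp.single 2 y (1 : ℝ)) x = (HpOp (P.L ^ j) (Mk P j) (EK hj x) y).re := by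
  have h := hP_apply_eq_sum hc hj (PiLp.single 2 y (1 : ℝ)) x
  have hsum : ∑ y' : Site P j, HpOp (P.L ^ j) (Mk P j) (EK hj x) y' * (((PiLp.single 2 y (1 : ℝ) : USite P j) y' : ℝ) : ℂ)
      = HpOp (P.L ^ j) (Mk P j) (EK hj x) y := by
    rw [Finset.sum_eq_single y]
    · rw [PiLp.single_apply, if_pos rfl, Complex.ofReal_one, mul_one]
    · intro y' _ hy'
      rw [PiLp.single_apply, if_neg hy', Complex.ofReal_zero, mul_zero]
    · intro hy; exact absurd (Finset.mem_univ y) hy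
  rw [hsum] at h
  rw [← h, Complex.ofReal_re]

/-- **hence p. 241 *"H′_j is a bounded operator with an exponential decay"* / p. 246 *"uniformly bounded … uniform exponential decay"*
for the CONCRETE `H′_j` are r03's kernel bounds BY NAME**: `|H′_j(x, y)| ≤ ‖HpOp (EK x) y‖` (then `…B6Hprime2132Torus.norm_HpOp_le`,
`norm_dker_le`, `norm_dker_sub_le`). [cite: Balaban1984PropagatorsII, (2.132) p.246] -/
theorem abs_hP_single_le_norm_HpOp (y : Site P j) (x : Site P 0) :
    |hP hc j (PiLp.single 2 y (1 : ℝ)) x| ≤ ‖HpOp (P.L ^ j) (Mk P j) (EK hj x) y‖ := by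
  rw [hP_single_apply hc hj]
  exact Complex.abs_re_le_norm _

/-- the concrete `H′_j` does not depend on the weight `c` of the Laplacian used to construct it. [cite: Balaban1984PropagatorsII, (2.101) p.241] -/
theorem hP_indep (hj : j ≤ P.m + P.K) {c' : ℝ} (hc' : c' ≠ 0) (μ : USite P j) : hP hc j μ = hP hc' j μ := by
  apply PiLp.ext
  intro x
  have h1 := hP_apply_eq hc hj μ x
  have h2 := hP_apply_eq hc' hj μ x
  exact_mod_cast h1.trans h2.symm

/-- `H′_j` of this file is the field `hP` of the two-scale data `tsV1` (definitionally). [cite: Balaban1984PropagatorsII, (2.101) p.241] -/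
theorem tsV1_hP (Λ' : Finset (Site P (j + 1))) (w : CIdx j Λ' → ℝ) : (tsV1 hc Λ' w).hP = hP hc j := rfl

end Literature.MathematicalPhysics.QuantumFieldTheory.Balaban1983to89.B6Hprime2101TwoScaleV1Torus

end
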